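import Summits.CriticalPhenomena.SAWScalingLimit.Theorems.SAWTotalPositivityCriticalBubbleBoundDockingTracks

/-!
# Line `docking-census-joining` (crux stmt-CriticalPhenomena-7117): the rooted polygon of a SAW is a polygon

Registered infrastructure sub-goal `isPolygon_pedges` of the line, discharged from the landed
`Docking.pedges_shift_isPolygon` (translate by `0`): for `ω ∈ Zd.sawFun 2 n e₀` with `n ≥ 3`
(indeed `n ≥ 2`), the edge set `pedges n ω` — the `n` steps of `ω` plus the root edge `{e₀, 0}` —
is a self-avoiding polygon of `ℤ²` in the sense of `IsPolygon` (Madras–Slade Def. 3.2.1).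
-/

noncomputable section

open Literature.Probability.LatticeModels
open Literature.Probability.RandomPlanarGeometry Literature.Probability.RandomPlanarGeometry.SAW
open Summit.CriticalPhenomena.SAWScalingLimit.Theorems.CriticalBubbleBound.Negative (e₀)

namespace Summit.CriticalPhenomena.SAWScalingLimit.Theorems.CriticalBubbleBound.Docking

/-- The rooted polygon `pedges n ω` of an `n`-step SAW `ω : 0 → e₀` of `ℤ²`, `n ≥ 3`, is a lattice
polygon (the walk closed up by the bond `{e₀, 0}`). [cite: MadrasSlade1993, Definition 3.2.1] -/
theorem isPolygon_pedges : ∀ (n : ℕ) (ω : ℕ → Site 2), ω ∈ Zd.sawFun 2 n e₀ → 3 ≤ n → IsPolygon (zdGraph 2) (pedges n ω) := by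
  intro n ω hω hn
  have h := (pedges_shift_isPolygon hω (le_trans (by norm_num) hn) 0).1
  rwa [shift_by_zero] at h

/-- Edge count of the rooted polygon: `#pedges n ω = n + 1` for `ω ∈ sawFun 2 n e₀`, `n ≥ 2`.
[cite: MadrasSlade1993, Definition 3.2.1] -/
theorem card_pedges {n : ℕ} {ω : ℕ → Site 2} (hω : ω ∈ Zd.sawFun 2 n e₀) (hn : 2 ≤ n) :
    (pedges n ω).card = n + 1 := by
  have h := (pedges_shift_isPolygon hω hn 0).2
  rwa [shift_by_zero] at h

end Summit.CriticalPhenomena.SAWScalingLimit.Theorems.CriticalBubbleBound.Docking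

end
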